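import Summits.NavierStokesRegularity.NavierStokesRegularity.Theorems.StrainClockDoorsCompositionsB
import HarnessLib

/-!
# StrainClockDoorsClosers — S38 plates closed and ALL SIX DOORS CLOSED BY NAME (§6; the 7 `#print axioms` lines dropped)

P0-38 part 4 of 4: §6 (`strainFrameOn_holds`, `strainThresholdOn_holds` (by name over p661976), `strainRatioDoor_holds` (A0), `strainClockNoStretching_holds`, `strainClockLiouville_of_rigidMotion`, `rigidMotion_holds` (over p663033), `strainClockLiouville_holds`, `typeIAncientSubcriticalStrain_holds`, `typeIAncientStrainLaw_holds`, `typeIAncientStrainLiouville_holds`) of nsreg-p1 g32's `r36/Sketch38.lean` sha16 a4b540f36e6f6589 (ROUND-36 acb2d0e710b3adcc; PLATE-AID-38 §3),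
every declaration byte-identical, order preserved; landed by ns-s29-p2 g4 on LEAD ns-s30-p1 g3's key 2026-08-28T20:16:56Z (g),
`--supports stmt-NavierStokesRegularity-0056 --as helper`.  UNCONDITIONAL (no named-fact hypothesis).

HONEST FRAME: door family S38 «StrainClockDoors» = the strain-clock criteria (forward door A0 «StrainRatioDoor»; ANCIENT /
Type-I-ancient rate-free Liouville-type doors A1/A2) about HYPOTHETICAL blow-up profiles; items 0056 `NoTypeII`, 10661 and NS
regularity are NOT proved; nothing here is a route or a summit statement.
-/

noncomputable section

open MeasureTheory Set Function Filter Metric Real InnerProductSpace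
open _root_.Topology
open scoped ENNReal NNReal RealInnerProductSpace ContDiff Laplacian
open Literature.Analysis Literature.Analysis.FluidPDE
open Literature.Analysis.FluidPDE.VorticityDirectionDynamics

set_option linter.dupNamespace false

namespace Summit.NavierStokesRegularity.NavierStokesRegularity.Theorems.StrainDoors

open Summit.NavierStokesRegularity.NavierStokesRegularity.Theorems.ArgmaxDoors

-- nested operator types (second derivatives)
set_option maxSynthPendingDepth 3
/-! ## §6 Plates closed here; the doors -/

/-- **Plate F_S∘ «StrainFrameOn» PROVED** (port of `strainFrame_holds` to the closed slab: `[s₁,s₂] ⊆ closure (s₁,s₂)`,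
so the one-sided time derivative commutes with the space derivative there too). [folklore] -/
theorem strainFrameOn_holds : StrainFrameOn := by
  intro ν s₁ s₂ h12 u p hsol s hs x e
  have hU : UniqueDiffOn ℝ (Icc s₁ s₂) := uniqueDiffOn_Icc h12
  have hcl : Icc s₁ s₂ ⊆ closure (interior (Icc s₁ s₂)) := by
    intro y hy
    rw [interior_Icc, closure_Ioo h12.ne]
    exact hy
  rw [hsol.smooth_velocity.timeDerivWithin_fderiv_slice_apply hU hcl hs x e]
  set w : (EuclideanSpace ℝ (Fin 3)) → (EuclideanSpace ℝ (Fin 3)) := timeDerivWithin (Icc s₁ s₂) u s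
    with hw_def
  have hw : ContDiff ℝ ∞ w := (hsol.smooth_velocity.timeDerivWithin hU).contDiff_slice hs
  have hu : ContDiff ℝ ∞ (u s) := hsol.smooth_velocity.contDiff_slice hs
  have hu3 : ContDiff ℝ 3 (u s) := contDiff_infty.1 hu 3
  have hwd : Differentiable ℝ w := (contDiff_infty.1 hw 1).differentiable one_ne_zero
  have hud : Differentiable ℝ (u s) := (contDiff_infty.1 hu 1).differentiable one_ne_zero
  have hDud : Differentiable ℝ (fderiv ℝ (u s)) :=
    ((contDiff_infty.1 hu 2).fderiv_right (m := 1) le_rfl).differentiable one_ne_zero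
  have hΔd : Differentiable ℝ (Δ (u s)) := differentiable_laplacian hu3
  have hcd : Differentiable ℝ (convect (u s) (u s)) := by
    have : convect (u s) (u s) = fun y => fderiv ℝ (u s) y (u s y) := rfl
    rw [this]
    exact hDud.clm_apply hud
  -- the momentum equation solved for the pressure gradient
  have hgrad : gradient (p s) = fun y => ν • (Δ (u s)) y - w y - convect (u s) (u s) y := by
    funext y
    have hm := hsol.momentum s hs y
    have h0 : (0 : ℝ → (EuclideanSpace ℝ (Fin 3)) → (EuclideanSpace ℝ (Fin 3))) s y = 0 := rfl
    rw [h0, add_zero] at hm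
    rw [← sub_eq_zero] at hm ⊢
    rw [← hm]
    abel
  rw [hgrad]
  have d1 : DifferentiableAt ℝ (fun y => ν • (Δ (u s)) y) x := (hΔd x).const_smul ν
  have d2 : DifferentiableAt ℝ (fun y => ν • (Δ (u s)) y - w y) x := d1.sub (hwd x)
  rw [fderiv_fun_sub d2 (hcd x), fderiv_fun_sub d1 (hwd x), fderiv_fun_const_smul (hΔd x) ν]
  simp only [sub_apply, FunLike.coe_smul, Pi.smul_apply]
  abel

/-- **Plate E2_S∘ «StrainThresholdOn» CLOSED BY NAME**: LEAD ns-s30-p1 g3's p661976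
`ArgmaxDoors.strainThresholdAncient` (`Theorems/StrainDoorsThresholdAncient.lean`; the device p657155 with
`W(r,y) := ∇u(r + s₁, y)` on `[0, s₂ − s₁]`, `IsSmoothSpaceTimeOn.comp_add_right`, `timeDerivWithin_comp_add_right`,
`HasDerivWithinAt.clm_apply`). [folklore] -/
theorem strainThresholdOn_holds : StrainThresholdOn := strainThresholdAncient

set_option maxHeartbeats 800000 in
/-- **Door A0 «StrainRatioDoor» PROVED** over the landed S37 machinery: a bound `M` for the strain form at `t₀`
(slab `Cᵏ` bounds on `[0,(t₀+T)/2]`); on `[t₀,T)` the CONSTANT barrier `B ≡ M' := max M l₀ + 1`, `φ ≡ −(1−c)M'`,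
fed to the linear device E2_S♭-lin `strainThresholdAlmostLinear_holds` on every `[t₀,t₂]`, `t₂ < T` (growth at the
charged points from E1_S♭ + F_S + the door hypothesis, the point lying above `l₀ < M' < q`); hence `Λ ≤ M'` on
`[t₀,T)`, so `(T − t)Λ(t) ≤ 1/2` on `[max t₀ (T − 1/(2M')), T)` and door Λ `subcriticalStrainDoor_holds` extends.
[folklore] -/
theorem strainRatioDoor_holds : StrainRatioDoor := by
  intro ν T t₀ l₀ c δ hν ht₀ ht₀T hl₀ hc hδ hδ1 u p hsol hreg hhyp
  have hT : 0 < T := lt_of_le_of_lt ht₀ ht₀T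
  set κ : ℝ := 1 - c with hκ
  have hκ0 : 0 < κ := by rw [hκ]; linarith
  -- slab sup of `|u|`
  have hK : ∀ t₂ : ℝ, 0 < t₂ → t₂ < T →
      ∃ K₀ : ℝ, 0 ≤ K₀ ∧ ∀ t ∈ Icc 0 t₂, ∀ x : EuclideanSpace ℝ (Fin 3), ‖u t x‖ ≤ K₀ := by
    intro t₂ ht₂0 ht₂T
    have hS : IsClassicalNSSolutionOn (Icc 0 t₂) ν 0 u p :=
      hsol.mono (Icc_subset_Ico_right ht₂T) (uniqueDiffOn_Icc ht₂0)
    exact exists_forall_norm_le_of_hasBoundedSobolevNormsOn hS (hreg t₂ ht₂T)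
  -- ### Step 1: the strain form at `t₀` is bounded
  obtain ⟨M, hM0, hM⟩ : ∃ M : ℝ, 0 ≤ M ∧
      ∀ (x e : EuclideanSpace ℝ (Fin 3)), ‖e‖ = 1 → strainQuad u t₀ x e ≤ M := by
    set T'' : ℝ := (t₀ + T) / 2 with hT''
    have hT''T : T'' < T := by rw [hT'']; linarith
    have ht₀T'' : t₀ ≤ T'' := by rw [hT'']; linarith
    have hsm : ∀ r ∈ Icc 0 T'', ContDiff ℝ ∞ (u r) := fun r hr =>
      hsol.contDiff_velocity ⟨hr.1, lt_of_le_of_lt hr.2 hT''T⟩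
    obtain ⟨C1, hC1⟩ :=
      exists_forall_norm_iteratedFDeriv_le_of_hasBoundedSobolevNormsOn hsm (hreg T'' hT''T) 1
    refine ⟨max C1 0, le_max_right _ _, fun x e he => ?_⟩
    have h := hC1 t₀ ⟨ht₀, ht₀T''⟩ x
    rw [norm_iteratedFDeriv_one] at h
    exact ((strainQuad_le_opNorm u t₀ x he).trans h).trans (le_max_left _ _)
  set M' : ℝ := max M l₀ + 1 with hM'
  have hM'M : M < M' := by rw [hM']; linarith [le_max_left M l₀]
  have hM'l : l₀ < M' := by rw [hM']; linarith [le_max_right M l₀]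
  have hM'pos : 0 < M' := lt_of_le_of_lt hl₀ hM'l
  -- ### Step 2: `⟪∇u e,e⟫ ≤ M'` on `[t₀,T)` (constant barrier through the linear device)
  have hbound : ∀ t ∈ Ico t₀ T, ∀ (x e : EuclideanSpace ℝ (Fin 3)), ‖e‖ = 1 →
      strainQuad u t x e ≤ M' := by
    intro t ht x e he
    set t₂ : ℝ := (t + T) / 2 with ht₂
    have ht₀t₂ : t₀ < t₂ := by rw [ht₂]; linarith [ht.1, ht.2]
    have ht₂T : t₂ < T := by rw [ht₂]; linarith [ht.2]
    have htt₂ : t ≤ t₂ := by rw [ht₂]; linarith [ht.2]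
    obtain ⟨K₀, -, hK₀⟩ := hK t₂ (lt_of_le_of_lt ht₀ ht₀t₂) ht₂T
    have hrate : ∀ ε : ℝ, 0 < ε → ε ≤ 1 → ∀ s ∈ Ioc t₀ t₂, ∀ (x e : EuclideanSpace ℝ (Fin 3)), ‖e‖ = 1 →
        (∀ (y e' : EuclideanSpace ℝ (Fin 3)), ‖e'‖ = 1 →
          (1 + ε * ‖y‖ ^ 2)⁻¹ * strainQuad u s y e' ≤ (1 + ε * ‖x‖ ^ 2)⁻¹ * strainQuad u s x e) →
        (∀ (y e' : EuclideanSpace ℝ (Fin 3)), ‖e'‖ = 1 → (1 - δ) * strainQuad u s y e' ≤ strainQuad u s x e) →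
        (fun _ : ℝ => M') s < strainQuad u s x e →
        strainRate T u s x e ≤
          ((fun _ : ℝ => -κ * M') s + (6 * ν * ε + Real.sqrt ε * K₀)) * strainQuad u s x e := by
      intro ε hε _ s hs x e he hpen halm hbig
      have hsI : s ∈ Ico 0 T := ⟨ht₀.trans hs.1.le, lt_of_le_of_lt hs.2 ht₂T⟩
      have hsI' : s ∈ Ico t₀ T := ⟨hs.1.le, hsI.2⟩
      have hbig' : M' < strainQuad u s x e := hbig
      have hq0 : 0 < strainQuad u s x e := hM'pos.trans hbig'
      have hsm : ContDiff ℝ ∞ (u s) := hsol.smooth_velocity.contDiff_slice hsI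
      have heq := strainFrame_holds ν T hν hT u p hsol s hsI x e
      have hE := strainGrowthWeighted ν ε hν.le hε (u s) (p s) hsm x e he (fun y => hpen y e he) hq0.le _ heq
      have hfeed := hhyp s hsI' x e ⟨he, halm⟩ (hM'l.trans hbig')
      have hux : ‖u s x‖ ≤ K₀ := hK₀ s ⟨hsI.1, hs.2⟩ x
      have h1 : strainRate T u s x e ≤ -(strainQuad u s x e) ^ 2 + strainFeed u p s x e +
          (6 * ν * ε + Real.sqrt ε * ‖u s x‖) * strainQuad u s x e := by
        unfold strainRate strainQuad strainFeed pressureHess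
        linarith [hE]
      have hallow : (6 * ν * ε + Real.sqrt ε * ‖u s x‖) * strainQuad u s x e ≤
          (6 * ν * ε + Real.sqrt ε * K₀) * strainQuad u s x e := by
        apply mul_le_mul_of_nonneg_right _ hq0.le
        have := mul_le_mul_of_nonneg_left hux (Real.sqrt_nonneg ε)
        linarith
      have h3 : κ * (M' * strainQuad u s x e) ≤ κ * (strainQuad u s x e * strainQuad u s x e) :=
        mul_le_mul_of_nonneg_left (mul_le_mul_of_nonneg_right hbig'.le hq0.le) hκ0.le
      have h4 : -(strainQuad u s x e) ^ 2 + c * strainQuad u s x e ^ 2 =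
          -κ * (strainQuad u s x e * strainQuad u s x e) := by
        rw [hκ]
        ring
      show strainRate T u s x e ≤ (-κ * M' + (6 * ν * ε + Real.sqrt ε * K₀)) * strainQuad u s x e
      linarith [h1, hallow, hfeed, h4, h3]
    exact strainThresholdAlmostLinear_holds ν T t₀ t₂ δ (fun ε => 6 * ν * ε + Real.sqrt ε * K₀) hν ht₀
      ht₀t₂ ht₂T hδ hδ1 (tendsto_allowance ν K₀) u p hsol hreg (fun _ => M') (fun _ => 0)
      (fun _ => -κ * M') continuousOn_const (fun _ _ => hM'pos)
      (fun s _ => hasDerivWithinAt_const s (Icc t₀ t₂) M')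
      (fun s _ => by have := mul_pos (mul_pos hκ0 hM'pos) hM'pos; linarith) hrate
      (fun x e he => (hM x e he).trans hM'M.le)
      t ⟨ht.1, htt₂⟩ x e he
  -- ### Step 3: door Λ with `y₀ = 1/2` on `[t₁, T)`
  set t₁ : ℝ := max t₀ (T - 1 / (2 * M')) with ht₁
  have ht₁0 : 0 ≤ t₁ := ht₀.trans (le_max_left _ _)
  have ht₁T : t₁ < T := by
    rw [ht₁]
    refine max_lt ht₀T ?_
    have := div_pos one_pos (mul_pos two_pos hM'pos)
    linarith
  refine subcriticalStrainDoor_holds ν T t₁ (1 / 2) hν ht₁0 ht₁T (by norm_num) u p hsol hreg ?_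
  intro t ht x e he
  have hq := hbound t ⟨(le_max_left _ _).trans ht.1, ht.2⟩ x e he
  have hTt : T - t ≤ 1 / (2 * M') := by
    have := (le_max_right t₀ (T - 1 / (2 * M'))).trans ht.1
    linarith
  have hTt0 : 0 < T - t := sub_pos.2 ht.2
  calc (T - t) * strainQuad u t x e ≤ (T - t) * M' := mul_le_mul_of_nonneg_left hq hTt0.le
    _ ≤ 1 / (2 * M') * M' := mul_le_mul_of_nonneg_right hTt hM'pos.le
    _ = 1 / 2 := by field_simp

/-- **Door A1♮ «StrainClockNoStretching» HOLDS** (both plates closed above). [folklore] -/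
theorem strainClockNoStretching_holds : StrainClockNoStretching :=
  strainClockNoStretching_of strainFrameOn_holds strainThresholdOn_holds

/-- **Door A1 «StrainClockLiouville» from plate «RigidMotion»** (closed by name just below). [folklore] -/
theorem strainClockLiouville_of_rigidMotion (hR : RigidMotion) : StrainClockLiouville :=
  strainClockLiouville_of strainClockNoStretching_holds hR

/-- plate «RigidMotion» CLOSED BY NAME (ns-sfl-p1 g5, p663033 `ArgmaxDoors.eq_of_strain_eq_zero_of_bounded`). -/
theorem rigidMotion_holds : RigidMotion := fun _ hV hS ⟨_, hM⟩ x y =>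
  (eq_of_strain_eq_zero_of_bounded hV hS hM x).trans (eq_of_strain_eq_zero_of_bounded hV hS hM y).symm

/-- **door A1 «StrainClockLiouville» CLOSED** (no hypothesis): the strain clock + the trace step + Killing rigidity. -/
theorem strainClockLiouville_holds : StrainClockLiouville :=
  strainClockLiouville_of_rigidMotion rigidMotion_holds

/-- **Door A2♮ «TypeIAncientSubcriticalStrain» HOLDS.** [folklore] -/
theorem typeIAncientSubcriticalStrain_holds : TypeIAncientSubcriticalStrain :=
  typeIAncientSubcriticalStrain_of strainFrameOn_holds strainThresholdOn_holds

/-- **Door A2 «TypeIAncientStrainLaw» HOLDS** (conditional Liouville for Type-I bounded ancient solutions under the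
one-point dimensionless strain-feed hypothesis; LEAD's ancient vorticity law by name). [folklore] -/
theorem typeIAncientStrainLaw_holds : TypeIAncientStrainLaw :=
  typeIAncientStrainLaw_of typeIAncientSubcriticalStrain_holds

/-- **Door A2♯ «TypeIAncientStrainLiouville» HOLDS.** [folklore] -/
theorem typeIAncientStrainLiouville_holds : TypeIAncientStrainLiouville :=
  typeIAncientStrainLiouville_of typeIAncientSubcriticalStrain_holds

end Summit.NavierStokesRegularity.NavierStokesRegularity.Theorems.StrainDoors

end
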